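/-
COR-CM (cell pub-hodgecm2, stage 2 of the Hodge ladder) — Δ2 BRIDGE, ORIENTATION AUDIT, TEST T2 — THE COMPOSITE WITH EVERY BINDER BY VALUE
(wb-9, transport route; sequel to `OrientationT2Inconsistency`).
THEOREMS ONLY; nothing landed is edited or restated; no named fact, no `sorry`.  HC_CM is NOT proved; «Δ2 BRIDGE CLOSED» is NOT claimed.
-/
import Summits.HodgeConjecture.CorCM.D2Bridge.OrientationT2Inconsistency
import Summits.HodgeConjecture.CorCM.D2Bridge.OrientationT2ConjAdm
import HarnessLib

/-!
# Δ2 bridge, orientation test T2 — composite with (D) discharged: the two readings of [Liu21, Thm. 4.18] at the literal pin are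
contradictory on every good `PhiMu` line carrying a non-zero oscillator module

`OrientationT2Inconsistency.false_of_thm418C_pin_of_prop413_of_hD` (wb-9) left ONE binder that was neither displayed nor a tree theorem:
`hD`, the `(0,1)` Hodge type of the restrictions of the block ([Liu21, (4.2) ∕ Prop. 4.13] read at the PATH-A pin `τ' = ῑ₁`).
`OrientationT2ConjAdm.res_block_pin_mem_piece_zero_one_of_thm418C_conjAdm` (wb-1) PRODUCES exactly that binder from the HYBRID reading
`𝔇ʰ.Thm418C` — the pinned dictionary with only the admissibility clause re-keyed at `ῑ₁ = conj ∘ ι₁` (the Δ2 lane's by-value terms at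
the `ῑ₁`-presented pieces feed this reading).  Composing the two: at the literal pin, for `L/ℚ` Galois,

  `𝔇.Thm418C ∧ 𝔇ʰ.Thm418C ∧ 𝔇.Prop413 ∧ (one nontrivial Ω i a) ∧ PhiMuLine ι₁ (line i) ⟹ False`,

with EVERY input either displayed by an END-shaped statement (`h418`, `h418h`, `h413`, the nontrivial oscillator module) or a tree
theorem ((T1) prove-8 `cmClasses_subset_hodge_piece_one_zero_pin`; `block ≠ ⊥` item6-p3 `block_ne_bot_of_prop413`; tower separation
wb-9 `submodule_tower_eq_bot_of_res_eq_zero`; the orientation lemma own-crow `tau_notMem_cmType_of_isReflexOfType_starRingEnd_comp`).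
Reading: the port's `ι₁`-keyed `h418` and Liu's theorem read at `ῑ₁` cannot both be fed on a `PhiMu` line with a non-zero block —
the kernel form of ORIENTATION-MEMO v1.3 §8 for the pair (live, hybrid).
-/

set_option autoImplicit false

noncomputable section

namespace Summit.HodgeConjecture.CorCM.D2Bridge

open HodgeCM HodgeCM.Model
open HodgeCM.Literature.Theta HodgeCM.Literature.Theta.LiuAlbaneseModuleDatum
open Literature.AlgebraicGeometry.HodgeTheory
open Literature.NumberTheory.Automorphic.PicardCM
open Literature.NumberTheory.Transcendental (Arapura2012_Cor_15_4_6)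

variable {L : CMField} {ι₁ : L →+* ℂ} (V : HermSpace3 L ι₁) (I : Type) (line : I → SplitLineE V)

/-- **T2 COMPOSITE, EVERY BINDER BY VALUE: at the literal pin, `𝔇.Thm418C ∧ 𝔇ʰ.Thm418C ∧ 𝔇.Prop413 ∧ (Ω i a nontrivial) ⟹ False`
at every `PhiMu` line.**  `L/ℚ` Galois.  `𝔇 = liuDictionaryPin … V I line` (admissibility keyed `ι₁`); `𝔇ʰ` = the same tower
dictionary with admissibility `d.IsReflexOfTypeG ῑ₁ (typeOfLine (line i))` (`H`, `block`, `res`, `PhiMu` identical).  Proof: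
wb-1's `res_block_pin_mem_piece_zero_one_of_thm418C_conjAdm` supplies the typed (D) of wb-9's `false_of_thm418C_pin_of_prop413_of_hD`.
[cite: VoisinHodgeI2002, §6.1.3 Cor. 6.14] [cite: Shimura1998, §8.3 Prop. 28] [cite: Liu2021, Remark 4.4 (TeX ll. 1930–1933)] -/
theorem false_of_thm418C_pin_of_prop413_of_thm418C_conjAdm [IsGalois ℚ (L : Type)]
    (hHD : exists_isReal_hodgeModel) (hI : hodgePQ_independent_of_hodgeModel)
    (h₁ : BallQuotientUniformised) (h₃ : CMAbelianVarietyRealised) (hA : Arapura2012_Cor_15_4_6) (i : I)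
    (h418 : (liuDictionaryPin hHD hI h₁ h₃ hA V I line).Thm418C) (h413 : (liuDictionaryPin hHD hI h₁ h₃ hA V I line).Prop413)
    (hΦ : SplitLine.PhiMuLine ι₁ (line i))
    (a : (liuDictionaryPin hHD hI h₁ h₃ hA V I line).Adm i) [Nontrivial ((liuDictionaryPin hHD hI h₁ h₃ hA V I line).Ω i a)]
    (h418h : (LiuDictionary.ofTower hHD hI h₁ h₃ hA V I (fun i => {χ : (line i).CharW // (line i).IsAutChar χ})
      (fun i a => (line i).Ω (ιVE V) a.1) (fun i => SplitLine.PhiMuLine ι₁ (line i))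
      (fun i dd => dd.IsReflexOfTypeG ((starRingEnd ℂ).comp ι₁) (SplitLine.typeOfLine (line i)))).Thm418C) : False :=
  false_of_thm418C_pin_of_prop413_of_hD V I line hHD hI h₁ h₃ hA i h418 h413 hΦ a
    (res_block_pin_mem_piece_zero_one_of_thm418C_conjAdm V I line hHD hI h₁ h₃ hA i hΦ h418h)

/-- **Block form, every binder by value except the two readings: `𝔇.Thm418C ∧ 𝔇ʰ.Thm418C ∧ 𝔇.Prop413 ⟹` no `PhiMu` line of the
literal pin carries a nontrivial oscillator module `Ω i a`** (contrapositive packaging of the previous theorem: the readings coexist only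
where [Liu21, Lem. D.1 (1)]'s non-vanishing fails).  [cite: VoisinHodgeI2002, §6.1.3 Cor. 6.14] [cite: Shimura1998, §8.3 Prop. 28] -/
theorem not_nontrivial_omega_pin_of_thm418C_of_prop413_of_thm418C_conjAdm [IsGalois ℚ (L : Type)]
    (hHD : exists_isReal_hodgeModel) (hI : hodgePQ_independent_of_hodgeModel)
    (h₁ : BallQuotientUniformised) (h₃ : CMAbelianVarietyRealised) (hA : Arapura2012_Cor_15_4_6) (i : I)
    (h418 : (liuDictionaryPin hHD hI h₁ h₃ hA V I line).Thm418C) (h413 : (liuDictionaryPin hHD hI h₁ h₃ hA V I line).Prop413)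
    (hΦ : SplitLine.PhiMuLine ι₁ (line i))
    (h418h : (LiuDictionary.ofTower hHD hI h₁ h₃ hA V I (fun i => {χ : (line i).CharW // (line i).IsAutChar χ})
      (fun i a => (line i).Ω (ιVE V) a.1) (fun i => SplitLine.PhiMuLine ι₁ (line i))
      (fun i dd => dd.IsReflexOfTypeG ((starRingEnd ℂ).comp ι₁) (SplitLine.typeOfLine (line i)))).Thm418C)
    (a : (liuDictionaryPin hHD hI h₁ h₃ hA V I line).Adm i) :
    ¬ Nontrivial ((liuDictionaryPin hHD hI h₁ h₃ hA V I line).Ω i a) := fun hnt =>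
  @false_of_thm418C_pin_of_prop413_of_thm418C_conjAdm L ι₁ V I line _ hHD hI h₁ h₃ hA i h418 h413 hΦ a hnt h418h

end Summit.HodgeConjecture.CorCM.D2Bridge

end
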